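import Summits.QuantumFields.YangMills.Theorems.ColdStartUniversalityLatticeLangevinTimeAverageHoeffding
import Summits.QuantumFields.YangMills.Theorems.ColdStartUniversalityLatticeLangevinDiscreteSamplingHoeffding
import Mathlib.MeasureTheory.OuterMeasure.BorelCantelli
import Mathlib.Analysis.PSeries
import HarnessLib

/-!
# Route `ColdStartUniversality` (fixed-cut-off SZZ dynamics): ★★★ ALMOST-SURE CONVERGENCE RATE `O(√(log T / T))` FOR THE COLD-START SAMPLER
# (Hoeffding + Borel–Cantelli), time averages and discrete samples

Helper file (seat `ym-line-csu-p1`, g34; `--supports stmt-QuantumFields-24809`).  File 52 proved the almost-sure ergodic theorem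
`T⁻¹∫₀ᵀ G(U_r) dr → μ_(β')(G)` (no rate) and file 54 its discrete analogue; the exponential deviation bounds of files 70/71 upgrade them, through the
first Borel–Cantelli lemma, to an ALMOST-SURE RATE of the law-of-the-iterated-logarithm order up to the logarithm: there are `C, c > 0` (`L, β'`
only) such that for EVERY strong solution of the SU(2) SZZ dynamics from a deterministic start on ANY probability space (e.g. the cold start),
* ★★★ `ae_eventually_abs_timeAverage_sub_wilson_lt` — for every continuous `G` with `|G| ≤ 1`: almost surely, for all sufficiently large `n : ℕ`,
  `|n⁻¹ ∫_(0,n] G(U_r) dr − μ_(β')(G)| < √(1152·(C/c)·log n / n)`;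
* ★★★ `ae_eventually_abs_average_sub_wilson_lt` — for every bounded measurable `G` with `|G| ≤ 1` and every step `h > 0`, `g = max(1, C/(1−e^(−ch)))`:
  almost surely, for all sufficiently large `N`, `|N⁻¹ Σ_(k<N) G(U_(kh)) − μ_(β')(G)| < 8·g·√(log N / N)`;
both from the generic ★ `ae_eventually_abs_lt_sqrt_log_div` (sub-Gaussian tails `2e^(−(n+1)ε²/a)` ⇒ a.s. eventually `|X_n| < √(2a·log(n+1)/(n+1))`,
`Σ 2/(n+1)² < ∞`, `MeasureTheory.ae_eventually_notMem`).  THEOREMS ONLY, no definition, no sorry; [folklore].  HONEST FRAMING: fixed cut-off,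
volume-dependent constants; `UniformColdStartMixing` (24809) is NOT restated; no crux, rung or summit statement is proved; the Yang–Mills mass gap is
NOT proved.
-/

set_option autoImplicit false

noncomputable section

namespace Summit.QuantumFields.YangMills.Theorems.ColdStartUniversality

open MeasureTheory ProbabilityTheory Filter Topology Set
open scoped NNReal ENNReal BigOperators
open Literature Literature.Probability.Process Literature.MathematicalPhysics.QuantumFieldTheory
open Literature.MathematicalPhysics.QuantumLattice (fundamentalRep fundamentalLatticeRep continuous_fundamentalRep)

/-! ## §1. Generic: sub-Gaussian tails give the almost-sure rate `√(2a log n / n)` -/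

/-- ★ **Borel–Cantelli rate from sub-Gaussian tails.**  If `P[|X_n| ≥ ε] ≤ 2·exp(−(n+1)ε²/a)` for all `n` and all `ε > 0` (`a > 0`), then almost
surely `|X_n| < √(2a·log(n+1)/(n+1))` for all sufficiently large `n`. [folklore] -/
theorem ae_eventually_abs_lt_sqrt_log_div {Ω : Type*} [MeasurableSpace Ω] {P : Measure Ω} [IsProbabilityMeasure P]
    (X : ℕ → Ω → ℝ) {a : ℝ} (ha : 0 < a)
    (hX : ∀ (n : ℕ) (ε : ℝ), 0 < ε → P.real {ω | ε ≤ |X n ω|} ≤ 2 * Real.exp (-((n + 1) * ε ^ 2) / a)) :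
    ∀ᵐ ω ∂P, ∀ᶠ n : ℕ in atTop, |X n ω| < Real.sqrt (2 * a * Real.log (n + 1) / (n + 1)) := by
  set s : ℕ → Set Ω := fun n => {ω | Real.sqrt (2 * a * Real.log (n + 1) / (n + 1)) ≤ |X n ω|} with hs
  -- `P(s_n) ≤ 2/(n+1)²`
  have hbound : ∀ n : ℕ, P.real (s n) ≤ 2 / ((n : ℝ) + 1) ^ 2 := by
    intro n
    have hn1 : (0 : ℝ) < (n : ℝ) + 1 := by positivity
    rcases Nat.eq_zero_or_pos n with hn | hn
    · subst hn
      calc P.real (s 0) ≤ 1 := measureReal_le_one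
        _ ≤ 2 / ((0 : ℕ) + 1 : ℝ) ^ 2 := by norm_num
    have hn' : (1 : ℝ) ≤ n := by exact_mod_cast hn
    have hlog : 0 < Real.log ((n : ℝ) + 1) := Real.log_pos (by linarith)
    have hε : 0 < Real.sqrt (2 * a * Real.log (n + 1) / (n + 1)) := Real.sqrt_pos.2 (by positivity)
    have h1 := hX n _ hε
    have hsq : Real.sqrt (2 * a * Real.log (n + 1) / (n + 1)) ^ 2 = 2 * a * Real.log (n + 1) / (n + 1) := Real.sq_sqrt (by positivity)
    have hexp : Real.exp (-(((n : ℝ) + 1) * Real.sqrt (2 * a * Real.log (n + 1) / (n + 1)) ^ 2) / a) = 1 / ((n : ℝ) + 1) ^ 2 := by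
      rw [hsq]
      have h2 : -(((n : ℝ) + 1) * (2 * a * Real.log (n + 1) / (n + 1))) / a = -Real.log (((n : ℝ) + 1) ^ 2) := by
        rw [Real.log_pow, Nat.cast_ofNat]
        field_simp
      rw [h2, Real.exp_neg, Real.exp_log (by positivity), one_div]
    calc P.real (s n) ≤ 2 * Real.exp (-(((n : ℝ) + 1) * Real.sqrt (2 * a * Real.log (n + 1) / (n + 1)) ^ 2) / a) := h1
      _ = 2 / ((n : ℝ) + 1) ^ 2 := by rw [hexp]; ring
  -- summability and Borel–Cantelli
  have hsum : Summable fun n : ℕ => 2 / ((n : ℝ) + 1) ^ 2 := by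
    have h1 : Summable fun n : ℕ => (((n + 1 : ℕ) : ℝ) ^ 2)⁻¹ := (summable_nat_add_iff 1).2 (Real.summable_nat_pow_inv.2 one_lt_two)
    have h2 := h1.mul_left 2
    refine h2.congr fun n => ?_
    push_cast
    ring
  have htsum : (∑' n, P (s n)) ≠ ∞ := by
    have hle : ∀ n, P (s n) ≤ ENNReal.ofReal (2 / ((n : ℝ) + 1) ^ 2) := fun n => by
      rw [← ofReal_measureReal]
      exact ENNReal.ofReal_le_ofReal (hbound n)
    refine ne_top_of_le_ne_top ?_ (ENNReal.tsum_le_tsum hle)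
    rw [← ENNReal.ofReal_tsum_of_nonneg (fun n => by positivity) hsum]
    exact ENNReal.ofReal_ne_top
  filter_upwards [ae_eventually_notMem htsum] with ω hω
  filter_upwards [hω] with n hn
  simpa only [hs, Set.mem_setOf_eq, not_le] using hn

/-- Index shift: `(∀ᶠ n, p (n+1)) → ∀ᶠ n, p n` on `ℕ`. [folklore] -/
theorem eventually_atTop_of_eventually_succ {p : ℕ → Prop} (h : ∀ᶠ n : ℕ in atTop, p (n + 1)) : ∀ᶠ n : ℕ in atTop, p n := by
  obtain ⟨N, hN⟩ := Filter.eventually_atTop.1 h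
  refine Filter.eventually_atTop.2 ⟨N + 1, fun n hn => ?_⟩
  obtain ⟨k, rfl⟩ : ∃ k, n = k + 1 := ⟨n - 1, by omega⟩
  exact hN k (by omega)

/-! ## §2. The almost-sure rate for time averages -/

variable {L : ℕ} [NeZero L]

/-- ★★★ **ALMOST-SURE CONVERGENCE RATE of time averages of the cold-start Langevin sampler** (every coupling, every start, every realisation;
`C, c` depend on `L, β'`): there are `C, c > 0` such that for EVERY strong solution `U` of the SU(2) SZZ dynamics from a deterministic start on
ANY probability space and every continuous `G` with `|G| ≤ 1`: almost surely, for all sufficiently large `n : ℕ`,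
`|n⁻¹ ∫_(0,n] G(U_r) dr − ∫ G dμ_(β')| < √(1152·(C/c)·log n / n)`. [folklore] -/
theorem ae_eventually_abs_timeAverage_sub_wilson_lt (L : ℕ) [NeZero L] (β' : ℝ) :
    ∃ C c : ℝ, 0 < C ∧ 0 < c ∧
      ∀ (x : GaugeConfig 3 L (Matrix.specialUnitaryGroup (Fin 2) ℂ))
        (Ω : Type) [MeasurableSpace Ω] (P : Measure Ω) [IsProbabilityMeasure P]
        (W : ℝ≥0 → Ω → (Edge 3 L × NoiseIdx 2 → ℝ)) (hW : IsFlatBrownian W P)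
        (U : ℝ≥0 → Ω → GaugeConfig 3 L (Matrix.specialUnitaryGroup (Fin 2) ℂ)),
        (∀ ω, U 0 ω = x) →
        (latticeLangevinDynamics (fundamentalLatticeRep 2) β').IsSolution (fundamentalRep (Fin 2)) hW.natFiltration P W U →
        ∀ (G : GaugeConfig 3 L (Matrix.specialUnitaryGroup (Fin 2) ℂ) → ℝ), Continuous G → (∀ z, |G z| ≤ 1) →
          ∀ᵐ ω ∂P, ∀ᶠ n : ℕ in atTop,
            |(n : ℝ)⁻¹ * (∫ r in Ioc 0 (n : ℝ), G (U r.toNNReal ω)) - ∫ z, G z ∂(wilsonMeasure (d := 3) (L := L) (fundamentalRep (Fin 2)) β')| <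
              Real.sqrt (1152 * (C / c) * Real.log n / n) := by
  obtain ⟨C, c, hC, hc, h⟩ := measureReal_timeAverage_deviation_le_exp L β'
  refine ⟨C, c, hC, hc, fun x Ω _ P _ W hW U hU0 hU G hG hG1 => ?_⟩
  set m : ℝ := ∫ z, G z ∂(wilsonMeasure (d := 3) (L := L) (fundamentalRep (Fin 2)) β') with hm
  set X : ℕ → Ω → ℝ := fun n ω => ((n : ℝ) + 1)⁻¹ * (∫ r in Ioc 0 ((n : ℝ) + 1), G (U r.toNNReal ω)) - m with hX
  have ha : (0 : ℝ) < 576 * C / c := by positivity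
  have htail : ∀ (n : ℕ) (ε : ℝ), 0 < ε → P.real {ω | ε ≤ |X n ω|} ≤ 2 * Real.exp (-((n + 1) * ε ^ 2) / (576 * C / c)) := by
    intro n ε hε
    have h1 := h x Ω P W hW U hU0 hU G hG hG1 ((n : ℝ) + 1) (by positivity) ε hε
    have heq : -(c * ((n : ℝ) + 1) * ε ^ 2) / (576 * C) = -(((n : ℝ) + 1) * ε ^ 2) / (576 * C / c) := by
      field_simp
    rw [heq] at h1
    exact h1
  have hmain := ae_eventually_abs_lt_sqrt_log_div X ha htail
  filter_upwards [hmain] with ω hω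
  refine eventually_atTop_of_eventually_succ ?_
  filter_upwards [hω] with n hn
  have heq : 2 * (576 * C / c) * Real.log ((n : ℝ) + 1) / ((n : ℝ) + 1) = 1152 * (C / c) * Real.log ((n + 1 : ℕ) : ℝ) / ((n + 1 : ℕ) : ℝ) := by
    push_cast
    ring
  have hX' : X n ω = (((n + 1 : ℕ) : ℝ))⁻¹ * (∫ r in Ioc 0 (((n + 1 : ℕ) : ℝ)), G (U r.toNNReal ω)) - m := by
    simp only [hX]
    push_cast
    ring_nf
  rw [← hX', ← heq]
  exact hn

/-! ## §3. The almost-sure rate for discrete samples -/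

/-- ★★★ **ALMOST-SURE CONVERGENCE RATE of discrete samples of the cold-start Langevin sampler** (every coupling, every start, every realisation,
every bounded measurable observable; `C, c` depend on `L, β'`): there are `C, c > 0` such that for EVERY strong solution `U` from a deterministic
start on ANY probability space, every measurable `G` with `|G| ≤ 1` and every step `h > 0`, with `g = max(1, C/(1−e^(−ch)))`: almost surely, for all
sufficiently large `N`, `|N⁻¹ Σ_(k<N) G(U_(kh)) − ∫ G dμ_(β')| < 8·g·√(log N / N)`. [folklore] -/
theorem ae_eventually_abs_average_sub_wilson_lt (L : ℕ) [NeZero L] (β' : ℝ) :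
    ∃ C c : ℝ, 0 < C ∧ 0 < c ∧
      ∀ (x : GaugeConfig 3 L (Matrix.specialUnitaryGroup (Fin 2) ℂ))
        (Ω : Type) [MeasurableSpace Ω] (P : Measure Ω) [IsProbabilityMeasure P]
        (W : ℝ≥0 → Ω → (Edge 3 L × NoiseIdx 2 → ℝ)) (hW : IsFlatBrownian W P)
        (U : ℝ≥0 → Ω → GaugeConfig 3 L (Matrix.specialUnitaryGroup (Fin 2) ℂ)),
        (∀ ω, U 0 ω = x) →
        (latticeLangevinDynamics (fundamentalLatticeRep 2) β').IsSolution (fundamentalRep (Fin 2)) hW.natFiltration P W U →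
        ∀ (G : GaugeConfig 3 L (Matrix.specialUnitaryGroup (Fin 2) ℂ) → ℝ), Measurable G → (∀ z, |G z| ≤ 1) →
        ∀ (h : ℝ≥0), 0 < h →
          ∀ᵐ ω ∂P, ∀ᶠ N : ℕ in atTop,
            |(N : ℝ)⁻¹ * (∑ k ∈ Finset.range N, G (U ((k : ℝ≥0) * h) ω)) - ∫ z, G z ∂(wilsonMeasure (d := 3) (L := L) (fundamentalRep (Fin 2)) β')| <
              8 * max 1 (C / (1 - Real.exp (-c * h))) * Real.sqrt (Real.log N / N) := by
  obtain ⟨C, c, hC, hc, hF⟩ := measureReal_average_deviation_le_exp L β'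
  refine ⟨C, c, hC, hc, fun x Ω _ P _ W hW U hU0 hU G hG hG1 h hh => ?_⟩
  set m : ℝ := ∫ z, G z ∂(wilsonMeasure (d := 3) (L := L) (fundamentalRep (Fin 2)) β') with hm
  set g : ℝ := max 1 (C / (1 - Real.exp (-c * h))) with hg
  have hg0 : 0 < g := one_pos.trans_le (le_max_left _ _)
  set X : ℕ → Ω → ℝ := fun n ω => ((n : ℝ) + 1)⁻¹ * (∑ k ∈ Finset.range (n + 1), G (U ((k : ℝ≥0) * h) ω)) - m with hX
  have ha : (0 : ℝ) < 32 * g ^ 2 := by positivity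
  have htail : ∀ (n : ℕ) (ε : ℝ), 0 < ε → P.real {ω | ε ≤ |X n ω|} ≤ 2 * Real.exp (-((n + 1) * ε ^ 2) / (32 * g ^ 2)) := by
    intro n ε hε
    have h1 := hF x Ω P W hW U hU0 hU G hG hG1 h hh (n + 1) ε hε
    push_cast at h1
    exact h1
  have hmain := ae_eventually_abs_lt_sqrt_log_div X ha htail
  filter_upwards [hmain] with ω hω
  refine eventually_atTop_of_eventually_succ ?_
  filter_upwards [hω] with n hn
  have hsq : Real.sqrt (2 * (32 * g ^ 2) * Real.log ((n : ℝ) + 1) / ((n : ℝ) + 1)) = 8 * g * Real.sqrt (Real.log ((n + 1 : ℕ) : ℝ) / ((n + 1 : ℕ) : ℝ)) := by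
    have h64 : 2 * (32 * g ^ 2) * Real.log ((n : ℝ) + 1) / ((n : ℝ) + 1) = (8 * g) ^ 2 * (Real.log ((n + 1 : ℕ) : ℝ) / ((n + 1 : ℕ) : ℝ)) := by
      push_cast
      ring
    rw [h64, Real.sqrt_mul (by positivity), Real.sqrt_sq (by positivity)]
  have hX' : X n ω = (((n + 1 : ℕ) : ℝ))⁻¹ * (∑ k ∈ Finset.range (n + 1), G (U ((k : ℝ≥0) * h) ω)) - m := by
    simp only [hX, Nat.cast_add, Nat.cast_one]
  rw [← hX', ← hsq]
  exact hn

end Summit.QuantumFields.YangMills.Theorems.ColdStartUniversality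

end
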